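import Summits.CriticalPhenomena.PercolationContinuityZ3.Theorems.PercNearOneGluingNoHeavyLowerTailSahiLatinChargeMonotone
import Summits.CriticalPhenomena.PercolationContinuityZ3.Theorems.PercNearOneGluingNoHeavyLowerTailSahiLatinReindex

/-!
# `NoHeavyLowerTail` (crux stmt-CriticalPhenomena-4575), Sahi programme (prim-master-conj gen 46): the JUMP SUM, the **JUMP CRITERION**
# `κ(τa,b,c) ≤ κ(a,b,c)`, and the **REFLECTION IDENTITY** `Σ_{±±±} κ(a^±,b^±,c^±) = 2[κ + κ(σa,b,c) + κ(a,σb,c) + κ(a,b,σc)]` (all `d`)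

Support file (`--supports stmt-CriticalPhenomena-4575`; sequel of `…SahiLatinChargeMonotone`; memo
`run/shared/lean/prim/prim-l12/FROM-prim-master-conj-g46-CHARGE-MONOTONICITY.md`).  Nothing here is specific to percolation; nothing is
asserted about the crux.

THE MATHEMATICS (all `d`; everything PROVED, axioms standard).  `τ = τ_{ll'}` is the transposition of the levels `l ≤ l'` of one axis
(`relabel` of `…SahiLatinRelabel`); `τa` is in general NOT an up-set.
* §1 JUMP SUM `kappa_sub_kappa_relabel_swap` (axis `none` of `Option κ`): for an up-set `a`,
  `κ(a,b,c) − κ(τa, b, c) = Σ_{x' ∈ a_{l'} ∖ a_l} (Φ_{bc}(glue l' x') − Φ_{bc}(glue l x'))` — only the JUMP POINTS of `a` across `(l,l')`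
  contribute; the other points of `a` pair off under the involution `τ`.
* §1 **JUMP CRITERION** `kappa_relabel_swap_le`: if `a, b, c` are up-sets and every jump point of `a` across `(l,l')` lies in `b ∩ c`, then
  `κ(τa, b, c) ≤ κ(a,b,c)` (charge monotonicity where the lower point is in `b ∩ c`, Lemmas R/A where it is not).
* §2 **REFLECTION IDENTITY** `sum_kappa_reflect` (ANY axis `i` of ANY index type, arbitrary finsets): with `s⁺ = s ∪ σs`, `s⁻ = s ∩ σs`,
  `Σ_{±±±} κ(a^±, b^±, c^±) = 2·[κ(a,b,c) + κ(σa,b,c) + κ(a,σb,c) + κ(a,b,σc)]` (multilinearity in the three slots + the relabelling symmetry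
  `κ(σx,σy,σz) = κ(x,y,z)`, which pairs the eight monomials).  It contains the Lieb–Sahi averaging identity `two_mul_kappa_eq` (two
  invariant slots) and shows: an up-set triple beats the AVERAGE of its eight reflections (all up-set triples for adjacent levels,
  `isUpperSet_union/inter_relabel_swap`) iff `3κ(a,b,c) ≥ κ(σa,b,c) + κ(a,σb,c) + κ(a,b,σc)`.
* §3 `sum_kappa_reflect_le`: under the jump criterion in all three slots `Σ_{±±±} ≤ 8κ(a,b,c)` — the REFLECTION-POSITIVITY step of the
  extremal (minimal-counterexample) scheme: such a triple is not a size-maximal minimiser unless all three sets are `τ`-invariant.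
* §4 TRANSPORT TO EVERY AXIS (`…SahiLatinReindex`): `Phi_le_Phi_update` (raising one coordinate of a point of `b ∩ c` does not decrease the
  charge, any axis `i` of any `ι`) and **`Phi_mono_of_mem_inter`**: for up-sets `b, c` and `u ≤ v` with `u ∈ b ∩ c`, `Φ_{bc}(u) ≤ Φ_{bc}(v)` —
  THE CHARGE IS ORDER-PRESERVING ON THE MEET, in every dimension.
HONEST LABEL: structure theorems about the kernel; the memo records that in `d = 3` these provable criteria leave gen 43's 26 extremal classes
unchanged (the distinguishing slots of an LS-free A-closed triple have jumps outside the meets); `LatinPos ι` (FBP(3,d), `d ≥ 5`), Sahi's `C₃`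
and Kahn's conjecture remain OPEN. [this work]
-/

namespace Summit.CriticalPhenomena.PercolationContinuityZ3.Theorems.SahiLatin

open Finset

section Axis

variable {κ : Type*} [Fintype κ] [DecidableEq κ]

/-! ## §1  The jump sum and the JUMP CRITERION -/

omit [Fintype κ] in
/-- Relabelling the axis `none` acts on glued points through the letter. [this work] -/
theorem relabelPt_none_glue (σ : Equiv.Perm (Fin 3)) (m : Fin 3) (x' : Pt κ) :
    relabelPt none σ (glue m x') = glue (σ m) x' := by
  funext o
  cases o with
  | none => rw [relabelPt_apply_self, glue_none, glue_none]
  | some k => rw [relabelPt_apply_of_ne none σ _ (Option.some_ne_none k), glue_some, glue_some]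

/-- **THE JUMP SUM** (all `κ`): for an up-set `a`, levels `l ≤ l'` and the transposition `τ` of the levels `l, l'` on the axis `none`,
`κ(a,b,c) − κ(τa, b, c) = Σ_{x' ∈ a_{l'} ∖ a_l} (Φ_{bc}(glue l' x') − Φ_{bc}(glue l x'))` — only the JUMP POINTS of `a` across
`(l,l')` contribute (the other points of `a` pair off under `τ`). [this work] -/
theorem kappa_sub_kappa_relabel_swap {a : Finset (Pt (Option κ))} (ha : IsUpperSet (a : Set (Pt (Option κ))))
    {l l' : Fin 3} (hll : l ≤ l') (b c : Finset (Pt (Option κ))) :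
    kappa a b c - kappa (relabel none (Equiv.swap l l') a) b c =
      ∑ x' ∈ sec a l' \ sec a l, (Phi b c (glue l' x') - Phi b c (glue l x')) := by
  set τ : Pt (Option κ) ≃ Pt (Option κ) := relabelPt none (Equiv.swap l l') with hτ
  have hττ : ∀ u, τ (τ u) = u := fun u => relabelPt_swap_swap none l l' u
  -- the relabelled sum is the sum of `Φ ∘ τ`
  have e1 : kappa (relabel none (Equiv.swap l l') a) b c = ∑ u ∈ a, Phi b c (τ u) := by
    rw [kappa_eq_sum_Phi, relabel, sum_map]
    rfl
  rw [kappa_eq_sum_Phi, e1, ← sum_sub_distrib]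
  -- split off the jump points
  set J : Finset (Pt (Option κ)) := a.filter fun u => u none = l' ∧ τ u ∉ a with hJ
  rw [← sum_filter_add_sum_filter_not a (fun u => u none = l' ∧ τ u ∉ a)]
  -- the non-jump part vanishes by the involution `τ`
  have hzero : ∑ u ∈ a.filter (fun u => ¬ (u none = l' ∧ τ u ∉ a)), (Phi b c u - Phi b c (τ u)) = 0 := by
    refine sum_involution (fun u _ => τ u) ?_ ?_ ?_ ?_
    · intro u _
      rw [hττ]; ring
    · intro u _ hne heq
      apply hne
      rw [heq, sub_self]
    · intro u hu
      rw [mem_filter] at hu ⊢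
      obtain ⟨hua, hnj⟩ := hu
      refine ⟨?_, fun h => h.2 (by rw [hττ]; exact hua)⟩
      -- `τ u ∈ a`
      by_cases h1 : u none = l
      · exact ha (le_relabelPt_swap hll h1) hua
      · by_cases h2 : u none = l'
        · by_contra hnot
          exact hnj ⟨h2, hnot⟩
        · rw [show τ u = u from relabelPt_swap_eq_self h1 h2]
          exact hua
    · intro u _
      exact hττ u
  rw [hzero, add_zero]
  -- identify the jump part with the section difference
  have key2 : ∀ u : Pt (Option κ), u none = l' → u = glue l' (fun k => u (some k)) := fun u hul => by
    funext o
    cases o with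
    | none => rw [glue_none]; exact hul
    | some k => rfl
  have key : ∀ u : Pt (Option κ), u none = l' → τ u = glue l (fun k => u (some k)) := fun u hul => by
    have e := congrArg τ (key2 u hul)
    rw [e, hτ, relabelPt_none_glue, Equiv.swap_apply_right]
  refine sum_nbij' (fun u => fun k => u (some k)) (fun x' => glue l' x') ?_ ?_ ?_ ?_ ?_
  · intro u hu
    rw [mem_filter] at hu
    obtain ⟨hua, hul, hτu⟩ := hu
    rw [mem_sdiff, mem_sec, mem_sec, ← key2 u hul, ← key u hul]
    exact ⟨hua, hτu⟩
  · intro x' hx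
    rw [mem_sdiff, mem_sec, mem_sec] at hx
    rw [mem_filter]
    refine ⟨hx.1, glue_none _ _, ?_⟩
    rw [hτ, relabelPt_none_glue, Equiv.swap_apply_right]
    exact hx.2
  · intro u hu
    rw [mem_filter] at hu
    exact (key2 u hu.2.1).symm
  · intro x' _
    rfl
  · intro u hu
    rw [mem_filter] at hu
    rw [key u hu.2.1, congrArg (Phi b c) (key2 u hu.2.1)]

/-- **THE JUMP CRITERION** (all `κ`): if `a, b, c` are up-sets and every jump point of `a` across the levels `l ≤ l'` of the axis
`none` lies in `b ∩ c` (`x' ∈ a_{l'} ∖ a_l ⟹ glue l' x' ∈ b ∩ c`), then reflecting `a` does not increase the kernel: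
`κ(τ_{ll'} a, b, c) ≤ κ(a, b, c)`.  (Charge monotonicity where the lower point is in `b ∩ c`, Lemmas R/A where it is not.) [this work] -/
theorem kappa_relabel_swap_le {a b c : Finset (Pt (Option κ))} (ha : IsUpperSet (a : Set (Pt (Option κ))))
    (hb : IsUpperSet (b : Set (Pt (Option κ)))) (hc : IsUpperSet (c : Set (Pt (Option κ)))) {l l' : Fin 3} (hll : l ≤ l')
    (hjump : ∀ x' ∈ sec a l' \ sec a l, glue l' x' ∈ b ∧ glue l' x' ∈ c) :
    kappa (relabel none (Equiv.swap l l') a) b c ≤ kappa a b c := by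
  have h := kappa_sub_kappa_relabel_swap ha hll b c
  have hnn : 0 ≤ ∑ x' ∈ sec a l' \ sec a l, (Phi b c (glue l' x') - Phi b c (glue l x')) := by
    refine sum_nonneg fun x' hx => ?_
    obtain ⟨hxb, hxc⟩ := hjump x' hx
    by_cases hlow : glue l x' ∈ b ∧ glue l x' ∈ c
    · linarith [Phi_glue_le_of_le hb hc hll hlow.1 hlow.2]
    · linarith [Phi_nonpos_of_not_mem hb hc hlow, Phi_nonneg_of_mem b c hxb hxc]
  linarith

end Axis

/-! ## §2  The REFLECTION IDENTITY (any axis of any index type) -/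

section Reflect

variable {ι : Type*} [Fintype ι] [DecidableEq ι]

omit [Fintype ι] in
/-- The transposition is an involution on sets. [this work] -/
theorem relabel_swap_swap (i : ι) (l l' : Fin 3) (s : Finset (Pt ι)) :
    relabel i (Equiv.swap l l') (relabel i (Equiv.swap l l') s) = s := by
  ext x
  rw [mem_relabel_swap, mem_relabel_swap, relabelPt_swap_swap]

/-- Modularity in the second slot. [this work] -/
theorem kappa_union_add_kappa_inter₂ (a b b' c : Finset (Pt ι)) :
    kappa a (b ∪ b') c + kappa a (b ∩ b') c = kappa a b c + kappa a b' c := by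
  rw [kappa_swap12 a (b ∪ b'), kappa_swap12 a (b ∩ b'), kappa_swap12 a b, kappa_swap12 a b']
  exact kappa_union_add_kappa_inter b b' a c

/-- Modularity in the third slot. [this work] -/
theorem kappa_union_add_kappa_inter₃ (a b c c' : Finset (Pt ι)) :
    kappa a b (c ∪ c') + kappa a b (c ∩ c') = kappa a b c + kappa a b c' := by
  rw [kappa_swap13 a b (c ∪ c'), kappa_swap13 a b (c ∩ c'), kappa_swap13 a b c, kappa_swap13 a b c']
  exact kappa_union_add_kappa_inter c c' b a

/-- **THE REFLECTION IDENTITY** (all `ι`, any axis `i`, `σ = τ_{ll'}` a transposition of two levels; arbitrary finsets): with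
`s⁺ = s ∪ σs`, `s⁻ = s ∩ σs`,
`Σ_{±±±} κ(a^±, b^±, c^±) = 2·[κ(a,b,c) + κ(σa,b,c) + κ(a,σb,c) + κ(a,b,σc)]`.
(Multilinearity gives the eight terms over `{a,σa} × {b,σb} × {c,σc}`; the relabelling symmetry `κ(σx,σy,σz) = κ(x,y,z)` pairs them off.)
For adjacent levels and up-sets all eight reflected triples are up-set triples (`isUpperSet_union/inter_relabel_swap`), so an up-set triple
beats the average of its reflections iff `3κ(a,b,c) ≥ κ(σa,b,c) + κ(a,σb,c) + κ(a,b,σc)`. [this work] -/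
theorem sum_kappa_reflect (i : ι) (l l' : Fin 3) (a b c : Finset (Pt ι)) :
    kappa (a ∪ relabel i (Equiv.swap l l') a) (b ∪ relabel i (Equiv.swap l l') b) (c ∪ relabel i (Equiv.swap l l') c)
      + kappa (a ∪ relabel i (Equiv.swap l l') a) (b ∪ relabel i (Equiv.swap l l') b) (c ∩ relabel i (Equiv.swap l l') c)
      + kappa (a ∪ relabel i (Equiv.swap l l') a) (b ∩ relabel i (Equiv.swap l l') b) (c ∪ relabel i (Equiv.swap l l') c)
      + kappa (a ∪ relabel i (Equiv.swap l l') a) (b ∩ relabel i (Equiv.swap l l') b) (c ∩ relabel i (Equiv.swap l l') c)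
      + kappa (a ∩ relabel i (Equiv.swap l l') a) (b ∪ relabel i (Equiv.swap l l') b) (c ∪ relabel i (Equiv.swap l l') c)
      + kappa (a ∩ relabel i (Equiv.swap l l') a) (b ∪ relabel i (Equiv.swap l l') b) (c ∩ relabel i (Equiv.swap l l') c)
      + kappa (a ∩ relabel i (Equiv.swap l l') a) (b ∩ relabel i (Equiv.swap l l') b) (c ∪ relabel i (Equiv.swap l l') c)
      + kappa (a ∩ relabel i (Equiv.swap l l') a) (b ∩ relabel i (Equiv.swap l l') b) (c ∩ relabel i (Equiv.swap l l') c)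
    = 2 * (kappa a b c + kappa (relabel i (Equiv.swap l l') a) b c + kappa a (relabel i (Equiv.swap l l') b) c
        + kappa a b (relabel i (Equiv.swap l l') c)) := by
  set a' := relabel i (Equiv.swap l l') a
  set b' := relabel i (Equiv.swap l l') b
  set c' := relabel i (Equiv.swap l l') c
  -- expand slot 3, then slot 2, then slot 1
  have s3 : ∀ x y, kappa x y (c ∪ c') + kappa x y (c ∩ c') = kappa x y c + kappa x y c' :=
    fun x y => kappa_union_add_kappa_inter₃ x y c c'
  have s2 : ∀ x z, kappa x (b ∪ b') z + kappa x (b ∩ b') z = kappa x b z + kappa x b' z :=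
    fun x z => kappa_union_add_kappa_inter₂ x b b' z
  have s1 : ∀ y z, kappa (a ∪ a') y z + kappa (a ∩ a') y z = kappa a y z + kappa a' y z :=
    fun y z => kappa_union_add_kappa_inter a a' y z
  -- relabelling symmetry pairs the eight monomials
  have r0 : kappa a' b' c' = kappa a b c := kappa_relabel i _ a b c
  have r1 : kappa a b' c' = kappa a' b c := by
    have := kappa_relabel i (Equiv.swap l l') a' b c
    rwa [show relabel i (Equiv.swap l l') a' = a from relabel_swap_swap i l l' a] at this
  have r2 : kappa a' b c' = kappa a b' c := by
    have := kappa_relabel i (Equiv.swap l l') a b' c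
    rwa [show relabel i (Equiv.swap l l') b' = b from relabel_swap_swap i l l' b] at this
  have r3 : kappa a' b' c = kappa a b c' := by
    have := kappa_relabel i (Equiv.swap l l') a b c'
    rwa [show relabel i (Equiv.swap l l') c' = c from relabel_swap_swap i l l' c] at this
  linear_combination (s3 (a ∪ a') (b ∪ b') + s3 (a ∪ a') (b ∩ b') + s3 (a ∩ a') (b ∪ b') + s3 (a ∩ a') (b ∩ b'))
    + (s2 (a ∪ a') c + s2 (a ∪ a') c' + s2 (a ∩ a') c + s2 (a ∩ a') c')
    + (s1 b c + s1 b c' + s1 b' c + s1 b' c') + r0 + r1 + r2 + r3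

end Reflect

/-! ## §3  Reflection positivity under the jump criterion (axis `none`) -/

section AxisReflect

variable {κ : Type*} [Fintype κ] [DecidableEq κ]

/-- Sections of a reflected set: `sec (τ_{ll'} s) m = sec s (τ_{ll'} m)`. [this work] -/
theorem sec_relabel_swap (l l' m : Fin 3) (s : Finset (Pt (Option κ))) :
    sec (relabel none (Equiv.swap l l') s) m = sec s (Equiv.swap l l' m) := by
  ext x'
  rw [mem_sec, mem_sec, mem_relabel_swap, relabelPt_none_glue]

/-- **REFLECTION POSITIVITY UNDER THE JUMP CRITERION** (all `κ`): if `a, b, c` are up-sets and, across the levels `l ≤ l'` of the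
axis `none`, the jump points of EACH slot lie in the meet of the other two, then the eight reflected triples have total kernel at most
`8κ(a,b,c)`; in particular `κ(a,b,c) ≥ min` over the eight (all up-set triples when the levels are adjacent), one of which,
`(a⁺,b⁺,c⁺)`, is strictly larger than `(a,b,c)` unless all three sets are `τ`-invariant — the extremal (minimal-counterexample) use. [this work] -/
theorem sum_kappa_reflect_le {a b c : Finset (Pt (Option κ))} (ha : IsUpperSet (a : Set (Pt (Option κ))))
    (hb : IsUpperSet (b : Set (Pt (Option κ)))) (hc : IsUpperSet (c : Set (Pt (Option κ)))) {l l' : Fin 3} (hll : l ≤ l')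
    (hja : ∀ x' ∈ sec a l' \ sec a l, glue l' x' ∈ b ∧ glue l' x' ∈ c)
    (hjb : ∀ x' ∈ sec b l' \ sec b l, glue l' x' ∈ a ∧ glue l' x' ∈ c)
    (hjc : ∀ x' ∈ sec c l' \ sec c l, glue l' x' ∈ a ∧ glue l' x' ∈ b) :
    kappa (a ∪ relabel none (Equiv.swap l l') a) (b ∪ relabel none (Equiv.swap l l') b) (c ∪ relabel none (Equiv.swap l l') c)
      + kappa (a ∪ relabel none (Equiv.swap l l') a) (b ∪ relabel none (Equiv.swap l l') b) (c ∩ relabel none (Equiv.swap l l') c)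
      + kappa (a ∪ relabel none (Equiv.swap l l') a) (b ∩ relabel none (Equiv.swap l l') b) (c ∪ relabel none (Equiv.swap l l') c)
      + kappa (a ∪ relabel none (Equiv.swap l l') a) (b ∩ relabel none (Equiv.swap l l') b) (c ∩ relabel none (Equiv.swap l l') c)
      + kappa (a ∩ relabel none (Equiv.swap l l') a) (b ∪ relabel none (Equiv.swap l l') b) (c ∪ relabel none (Equiv.swap l l') c)
      + kappa (a ∩ relabel none (Equiv.swap l l') a) (b ∪ relabel none (Equiv.swap l l') b) (c ∩ relabel none (Equiv.swap l l') c)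
      + kappa (a ∩ relabel none (Equiv.swap l l') a) (b ∩ relabel none (Equiv.swap l l') b) (c ∪ relabel none (Equiv.swap l l') c)
      + kappa (a ∩ relabel none (Equiv.swap l l') a) (b ∩ relabel none (Equiv.swap l l') b) (c ∩ relabel none (Equiv.swap l l') c)
    ≤ 8 * kappa a b c := by
  rw [sum_kappa_reflect]
  have h1 : kappa (relabel none (Equiv.swap l l') a) b c ≤ kappa a b c := kappa_relabel_swap_le ha hb hc hll hja
  have h2 : kappa a (relabel none (Equiv.swap l l') b) c ≤ kappa a b c := by
    rw [kappa_swap12, kappa_swap12 a b c]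
    exact kappa_relabel_swap_le hb ha hc hll hjb
  have h3 : kappa a b (relabel none (Equiv.swap l l') c) ≤ kappa a b c := by
    rw [kappa_swap13, kappa_swap13 a b c]
    exact kappa_relabel_swap_le hc hb ha hll (fun x' hx => ⟨(hjc x' hx).2, (hjc x' hx).1⟩)
  linarith

end AxisReflect

/-! ## §4  Transport: the charge is order-preserving on the meet, along every axis of every index type -/

section Transport

variable {ι : Type*} [Fintype ι] [DecidableEq ι]

omit [Fintype ι] in
/-- Re-indexing along `axisEquiv i` glues the `i`-th coordinate in front. [this work] -/
theorem ptCongr_axisEquiv (i : ι) (u : Pt ι) :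
    ptCongr (axisEquiv i) u = glue (u i) (fun k => ptCongr (axisEquiv i) u (some k)) := by
  funext o
  cases o with
  | none =>
    rw [glue_none, ptCongr_apply]
    exact congrArg u ((Equiv.symm_apply_eq _).2 (axisEquiv_self i).symm)
  | some k => rw [glue_some]

omit [Fintype ι] in
/-- Re-indexing the updated point glues the new level in front of the same restriction. [this work] -/
theorem ptCongr_axisEquiv_update (i : ι) (u : Pt ι) (l' : Fin 3) :
    ptCongr (axisEquiv i) (Function.update u i l') = glue l' (fun k => ptCongr (axisEquiv i) u (some k)) := by
  rw [ptCongr_update, axisEquiv_self]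
  funext o
  cases o with
  | none => rw [Function.update_self, glue_none]
  | some k => rw [Function.update_of_ne (Option.some_ne_none k), glue_some]

/-- The charge transports along a re-indexing. [this work] -/
theorem Phi_reindex {ι' : Type*} [Fintype ι'] [DecidableEq ι'] (e : ι ≃ ι') (b c : Finset (Pt ι)) (u : Pt ι) :
    Phi (reindex e b) (reindex e c) (ptCongr e u) = Phi b c u := by
  rw [Phi_eq_kappa_singleton, Phi_eq_kappa_singleton, ← kappa_reindex e {u} b c]
  congr 1

/-- **Raising one coordinate of a point of the meet does not decrease the charge** (any axis `i` of any `ι`): for up-sets `b, c`,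
`u ∈ b ∩ c` and `u i ≤ l'`, `Φ_{bc}(u) ≤ Φ_{bc}(u[i ↦ l'])`. [this work] -/
theorem Phi_le_Phi_update (i : ι) {b c : Finset (Pt ι)} (hb : IsUpperSet (b : Set (Pt ι))) (hc : IsUpperSet (c : Set (Pt ι)))
    {u : Pt ι} {l' : Fin 3} (hll : u i ≤ l') (hub : u ∈ b) (huc : u ∈ c) :
    Phi b c u ≤ Phi b c (Function.update u i l') := by
  set e := axisEquiv i
  rw [← Phi_reindex e b c u, ← Phi_reindex e b c (Function.update u i l'), ptCongr_axisEquiv i u,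
    ptCongr_axisEquiv_update i u l']
  have hub' : glue (u i) (fun k => ptCongr (axisEquiv i) u (some k)) ∈ reindex e b := by
    rw [← ptCongr_axisEquiv]; exact ptCongr_mem_reindex.2 hub
  have huc' : glue (u i) (fun k => ptCongr (axisEquiv i) u (some k)) ∈ reindex e c := by
    rw [← ptCongr_axisEquiv]; exact ptCongr_mem_reindex.2 huc
  exact Phi_glue_le_of_le (isUpperSet_reindex e hb) (isUpperSet_reindex e hc) hll hub' huc'

/-- **THE CHARGE IS ORDER-PRESERVING ON THE MEET** (all `ι`): for up-sets `b, c` and points `u ≤ v` with `u ∈ b ∩ c`,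
`Φ_{bc}(u) ≤ Φ_{bc}(v)` (raise the coordinates one at a time; the intermediate points stay in the up-set `b ∩ c`). [this work] -/
theorem Phi_mono_of_mem_inter {b c : Finset (Pt ι)} (hb : IsUpperSet (b : Set (Pt ι))) (hc : IsUpperSet (c : Set (Pt ι)))
    {u v : Pt ι} (huv : u ≤ v) (hub : u ∈ b) (huc : u ∈ c) : Phi b c u ≤ Phi b c v := by
  -- induction on the number of coordinates where `u` and `v` differ
  suffices h : ∀ (n : ℕ) (u : Pt ι), (univ.filter fun j => u j ≠ v j).card = n → u ≤ v → u ∈ b → u ∈ c →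
      Phi b c u ≤ Phi b c v from h _ u rfl huv hub huc
  intro n
  induction n with
  | zero =>
    intro u hcard huv _ _
    have : u = v := by
      funext j
      by_contra hj
      have : j ∈ (univ.filter fun j => u j ≠ v j) := mem_filter.2 ⟨mem_univ _, hj⟩
      rw [card_eq_zero.1 hcard] at this
      exact notMem_empty _ this
    rw [this]
  | succ n ih =>
    intro u hcard huv hub huc
    obtain ⟨j, hj⟩ : (univ.filter fun j => u j ≠ v j).Nonempty := by
      rw [← card_pos, hcard]; exact Nat.succ_pos n
    have hjne : u j ≠ v j := (mem_filter.1 hj).2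
    set u' := Function.update u j (v j) with hu'
    have huu' : u ≤ u' := by
      intro k
      by_cases hk : k = j
      · subst hk; rw [hu', Function.update_self]; exact huv k
      · rw [hu', Function.update_of_ne hk]
    have hu'v : u' ≤ v := by
      intro k
      by_cases hk : k = j
      · subst hk; rw [hu', Function.update_self]
      · rw [hu', Function.update_of_ne hk]; exact huv k
    have step : Phi b c u ≤ Phi b c u' := Phi_le_Phi_update j hb hc (huv j) hub huc
    have hcard' : (univ.filter fun k => u' k ≠ v k).card = n := by
      have hset : (univ.filter fun k => u' k ≠ v k) = (univ.filter fun k => u k ≠ v k).erase j := by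
        ext k
        rw [mem_erase, mem_filter, mem_filter]
        by_cases hk : k = j
        · subst hk
          simp [hu']
        · rw [hu', Function.update_of_ne hk]
          exact ⟨fun h => ⟨hk, h⟩, fun h => h.2⟩
      rw [hset, card_erase_of_mem hj, hcard]
      rfl
    exact step.trans (ih u' hcard' hu'v (hb huu' hub) (hc huu' huc))

end Transport

end Summit.CriticalPhenomena.PercolationContinuityZ3.Theorems.SahiLatin
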